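import Literature.NumberTheory.Automorphic.Liu2021.AppendixC.TowerMorphism
import HarnessLib

/-!
# [Liu 2021, Thm 4.15 / 4.18] the pull-back on `H¹_ét(A_∞)` of a morphism of towers, CONSTRUCTED — the étale receptacle
# `Sec42Data.EtaleTowerHom` from the geometric one `Sec42Data.TowerHom` (cell hodgecm-mathlib, KEY t2r2′ K-b)

Topic `NumberTheory/Automorphic/Liu2021/AppendixC`; namespace `Literature.NumberTheory.Automorphic.Liu2021.AppendixC`.
Continuation of `TowerMorphism.lean` (★ p640334: `Sec42Data.TowerHom` = an `E`-morphism of towers `{X⋆_{φ⁻¹K ∩ K₀⋆}} → {X_K}`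
along a continuous group map `φ`, compatible with the Hecke translates; `Sec42Data.EtaleTowerHom` = the same WITH a pull-back
`etPull ℓ : H¹_ét(A_∞) → H¹_ét(A⋆_∞)` subject to the one defining square `etPull [ψ]_K = [ᵗV_ℓ(Alb(map K)) ψ]_{φ⁻¹K ∩ K₀⋆}`).
Here the pull-back is CONSTRUCTED from the geometric datum, exactly as the Hecke action `HeckeTranslates.etHecke` of
`EtaleHeckeDatumOfTranslates.lean` is constructed from the translates: the level components
`ψ ↦ [ᵗV_ℓ(Alb(map K)) ψ]_{φ⁻¹K ∩ K₀⋆}` (`etPullAux`) are compatible with the transition maps `ᵗV_ℓ(Alb_u)` of the direct system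
(`etPullAux_sys` — `Alb(map L) ≫ Alb_u = Alb_{u⋆} ≫ Alb(map K)`, ★ `TowerHom.albMap_Atr`, dualised, and ★ `toTower_pull`), so
they glue to a `ℚ_ℓ`-linear map out of the colimit (`Module.DirectLimit.lift`, `etPullLift`), whose defining square is
`Module.DirectLimit.lift_of` (`etPullLift_toTower`).

## Contents (definitions with bodies + theorems; NO named fact, NO instance, NO `sorry`; net Literature debt 0)
* `Sec42Data.TowerHom.etPullAux`, `etPullAux_apply`, `etPullAux_sys`, **`etPullLift`**, `etPullLift_toTower`.
* **`Sec42Data.TowerHom.toEtaleTowerHom (M) : Sec42Data.EtaleTowerHom Cₛ C Tₛ T φ hφ`** (`map := M.map`, `etPull := etPullLift`);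
  `toEtaleTowerHom_toTowerHom`, `toEtaleTowerHom_map`, `toEtaleTowerHom_etPull` (`rfl`s).
* **`Sec42Data.nonempty_etaleTowerHom_of_towerHom`** : `Nonempty (TowerHom …) → Nonempty (EtaleTowerHom …)` — MEANING for
  the cell: the existence binder T2-R2′ of the (S)-split of [Liu2021] Thm 4.15 reduces to the existence of the GEOMETRIC
  morphism of towers `Sh(U(V⋆) × U(V⋆^⊥)) → Sh(U(V))` ([Milne2005ShimuraVarieties] Thm. 13.6 / Rem. 13.8); the étale half,
  with its `Γ_E`-equivariance and Hecke intertwining (★ `EtaleTowerHom.etPull_towerRep`, `etPull_etHeckeRep`), is a theorem.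
* **`Sec42Data.EtaleTowerHom.etPull_eq_etPullLift`** — every étale receptacle's pull-back IS the constructed one (★ `etPull_unique`):
  the étale structure carries no freedom beyond the geometric datum.

## References
* [Liu2021] Y. Liu, arXiv:2102.11518: §4.3 l. 2152–2160 (`H¹_ét(A_∞) = colim_K H¹_ét(A_K)`), Thm. 4.18 proof l. 2258–2290.
* [Milne2005ShimuraVarieties] J. S. Milne, *Introduction to Shimura varieties* (2005), Thm. 13.6 p. 118, Rem. 13.8 p. 119, §5 p. 58.
* [Milne1986AbelianVarieties] J. S. Milne, *Abelian varieties* (Cornell–Silverman 1986), Thm 15.1 (a) (`H¹_ét = (T_ℓ)^∨`).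
* Tree: `AppendixC.TowerMorphism` (★ p640334), `AppendixC.EtaleHeckeDatumOfTranslates` (the template `etHecke`,
  `dualMap_rationalTateModuleMap_comp_apply`), `AppendixC.EtaleH1Tower` (`etSys`, `toTower`, `toTower_pull`), `AppendixC.RestOne` (`Idx`).
-/

set_option autoImplicit false

noncomputable section

open CategoryTheory NumberField
open scoped TensorProduct

namespace Literature.NumberTheory.Automorphic.Liu2021.AppendixC

open Literature.AlgebraicGeometry.Motives (AbelianVariety)
open Literature.AlgebraicGeometry.Motives.AbelianVariety (rationalTateModuleMap rationalTateModuleMap_comp)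

section Sec42

variable {F E : Type} [Field F] [NumberField F] [IsTotallyReal F] [Field E] [NumberField E] [Algebra F E]
  [IsTotallyComplex E] [Algebra.IsQuadraticExtension F E]
variable {P5ₛ P5 : PropC5Data F E} {isoₛ iso : ℕ → Prop}

namespace Sec42Data.TowerHom

variable {Cₛ : Sec42Data P5ₛ isoₛ} {C : Sec42Data P5 iso} {Tₛ : Cₛ.HeckeTranslates} {T : C.HeckeTranslates}
  {φ : Cₛ.G →* C.G} {hφ : Continuous φ} (M : Sec42Data.TowerHom Cₛ C Tₛ T φ hφ) (ℓ : ℕ) [Fact ℓ.Prime]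

open RestOne (Idx)
open scoped Classical

/-! ## §1 The level components of the pull-back and their compatibility with the transition maps -/

/-- Level-`K` component of the pull-back: `ψ ↦ [ᵗV_ℓ(Alb(map K)) ψ]_{φ⁻¹K ∩ K₀⋆}` (`etPullLevel` followed by the canonical
map into the colimit `H¹_ét(A⋆_∞)`; cf. `HeckeTranslates.etHeckeAux`). [cite: Liu2021, §4.3 l. 2158 and Thm. 4.18 proof l. 2258–2262] -/
def etPullAux (K : C5.SmallLevel C.S.K₀) : C.etaleH1 ℓ K →ₗ[ℚ_[ℓ]] Cₛ.etaleH1Tower ℓ :=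
  Cₛ.toTower ℓ (M.src K) ∘ₗ M.etPullLevel ℓ K

/-- Unfolding of `etPullAux`. [cite: Liu2021, §4.3 l. 2158] -/
theorem etPullAux_apply (K : C5.SmallLevel C.S.K₀) (ψ : C.etaleH1 ℓ K) :
    M.etPullAux ℓ K ψ = Cₛ.toTower ℓ (M.src K) (M.etPullLevel ℓ K ψ) :=
  rfl

/-- **The level components are compatible with the transition maps** `ᵗV_ℓ(Alb_u)` of the direct system `K ↦ H¹_ét(A_K)`
(so they descend to the colimit): for `L ⊆ K`, `[ᵗV_ℓ(Alb(map L)) (ᵗV_ℓ(Alb_u) ψ)]_{φ⁻¹L ∩ K₀⋆} = [ᵗV_ℓ(Alb(map K)) ψ]_{φ⁻¹K ∩ K₀⋆}` —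
`Alb(map L) ≫ Alb_u = Alb_{u⋆} ≫ Alb(map K)` (★ `albMap_Atr`), contravariant functoriality of `ᵗV_ℓ`
(★ `dualMap_rationalTateModuleMap_comp_apply`) and `[·]_{L⋆} ∘ ᵗV_ℓ(Alb_{u⋆}) = [·]_{K⋆}` (★ `toTower_pull`); cf. `etHeckeAux_sys`.
[cite: Liu2021, §4.2 l. 2070 and §4.3 l. 2158] [cite: Milne2005ShimuraVarieties, Rem. 13.8 p. 119] -/
theorem etPullAux_sys (i j : Idx C) (hij : i ≤ j) (ψ : C.etSysObj ℓ i) :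
    M.etPullAux ℓ (OrderDual.ofDual j) (C.etSys ℓ i j hij ψ) = M.etPullAux ℓ (OrderDual.ofDual i) ψ := by
  have hle : OrderDual.ofDual j ≤ OrderDual.ofDual i := hij
  show Cₛ.toTower ℓ (M.src (OrderDual.ofDual j))
      ((rationalTateModuleMap ℓ (M.albMap (OrderDual.ofDual j))).dualMap
        ((rationalTateModuleMap ℓ (C.Atr (homOfLE hle))).dualMap ψ)) =
    Cₛ.toTower ℓ (M.src (OrderDual.ofDual i)) ((rationalTateModuleMap ℓ (M.albMap (OrderDual.ofDual i))).dualMap ψ)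
  rw [dualMap_rationalTateModuleMap_comp_apply, M.albMap_Atr (homOfLE hle), ← dualMap_rationalTateModuleMap_comp_apply,
    Cₛ.toTower_pull ℓ]

/-! ## §2 The pull-back on the colimit, glued by the universal property -/

/-- **The pull-back `H¹_ét(A_∞ ⊗_E Ē, ℚ_ℓ) → H¹_ét(A⋆_∞ ⊗_E Ē, ℚ_ℓ)` of a morphism of towers**, `ℚ_ℓ`-linear: the map out of the
colimit with level components `etPullAux` (`Module.DirectLimit.lift`; cf. `HeckeTranslates.etHecke`) — «the following map …» of
[Liu2021] Thm. 4.18 proof l. 2258–2262, along the sub-datum of step (S5) of Thm. 4.15's proof, CONSTRUCTED.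
[cite: Liu2021, §4.3 l. 2152–2160 and Thm. 4.18 proof l. 2258–2290] [cite: Milne2005ShimuraVarieties, Rem. 13.8 p. 119] -/
def etPullLift : C.etaleH1Tower ℓ →ₗ[ℚ_[ℓ]] Cₛ.etaleH1Tower ℓ :=
  Module.DirectLimit.lift ℚ_[ℓ] (Idx C) (C.etSysObj ℓ) (C.etSys ℓ) (fun i => M.etPullAux ℓ (OrderDual.ofDual i))
    fun i j hij ψ => M.etPullAux_sys ℓ i j hij ψ

/-- On a level class the pull-back is the level component (`Module.DirectLimit.lift_of`). [cite: Liu2021, §4.3 l. 2158] -/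
theorem etPullLift_of (K : C5.SmallLevel C.S.K₀) (ψ : C.etaleH1 ℓ K) :
    M.etPullLift ℓ (Module.DirectLimit.of ℚ_[ℓ] (Idx C) (C.etSysObj ℓ) (C.etSys ℓ) (OrderDual.toDual K) ψ) =
      M.etPullAux ℓ K ψ :=
  Module.DirectLimit.lift_of _ _ _

/-- **DEFINING SQUARE of the constructed pull-back**: `etPullLift [ψ]_K = [ᵗV_ℓ(Alb(map K)) ψ]_{φ⁻¹K ∩ K₀⋆}` — the one law of
`Sec42Data.EtaleTowerHom`. [cite: Liu2021, §4.3 l. 2158 and Thm. 4.18 proof l. 2258–2262] -/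
theorem etPullLift_toTower (K : C5.SmallLevel C.S.K₀) (ψ : C.etaleH1 ℓ K) :
    M.etPullLift ℓ (C.toTower ℓ K ψ) = Cₛ.toTower ℓ (M.src K) (M.etPullLevel ℓ K ψ) :=
  M.etPullLift_of ℓ K ψ

/-! ## §3 The étale receptacle from the geometric one -/

/-- **The étale receptacle CONSTRUCTED from a morphism of towers**: `map := M.map` and the glued pull-back `etPullLift`, the
defining square being `etPullLift_toTower`.  With ★ `EtaleTowerHom.etPull_towerRep` / `etPull_etHeckeRep` this makes the
`Γ_E`-equivariant, Hecke-intertwining pull-back of (S5) a CONSEQUENCE of the geometric datum ([Milne2005ShimuraVarieties] Rem. 13.8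
+ functoriality of the Albanese and of `V_ℓ`, both ★). [cite: Liu2021, §4.3 l. 2152–2160 and Thm. 4.18 proof l. 2258–2290]
[cite: Milne2005ShimuraVarieties, Rem. 13.8 p. 119 and Thm. 13.6 p. 118] -/
def toEtaleTowerHom : Sec42Data.EtaleTowerHom Cₛ C Tₛ T φ hφ where
  toTowerHom := M
  etPull ℓ' _ := M.etPullLift ℓ'
  etPull_toTower ℓ' _ K ψ := M.etPullLift_toTower ℓ' K ψ

/-- The geometric part of the constructed receptacle is `M` (`rfl`). [cite: Milne2005ShimuraVarieties, Rem. 13.8 p. 119] -/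
theorem toEtaleTowerHom_toTowerHom : M.toEtaleTowerHom.toTowerHom = M := rfl

/-- The level morphisms of the constructed receptacle are those of `M` (`rfl`). [cite: Milne2005ShimuraVarieties, Rem. 13.8 p. 119] -/
theorem toEtaleTowerHom_map : M.toEtaleTowerHom.map = M.map := rfl

/-- The pull-back of the constructed receptacle is `etPullLift` (`rfl`). [cite: Liu2021, §4.3 l. 2158] -/
theorem toEtaleTowerHom_etPull : M.toEtaleTowerHom.etPull ℓ = M.etPullLift ℓ := rfl

end Sec42Data.TowerHom

/-- **EXISTENCE HALF of the étale receptacle from the geometric one**: a morphism of towers over `E` along `φ` compatible with the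
translates yields one WITH its pull-back on `H¹_ét(A_∞)`.  MEANING (cell hodgecm-mathlib, LIU415-SPEC §7 T2-R2′): the one existence
binder of the (S)-split of [Liu2021] Thm. 4.15 is the GEOMETRIC functoriality `Sh(U(V⋆) × U(V⋆^⊥)) → Sh(U(V))` of the canonical
models ([Milne2005ShimuraVarieties] Thm. 13.6 / Rem. 13.8); nothing étale remains to be posited.
[cite: Milne2005ShimuraVarieties, Rem. 13.8 p. 119 and Thm. 13.6 p. 118] [cite: Liu2021, Thm. 4.18 proof l. 2258–2290] -/
theorem Sec42Data.nonempty_etaleTowerHom_of_towerHom {Cₛ : Sec42Data P5ₛ isoₛ} {C : Sec42Data P5 iso}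
    {Tₛ : Cₛ.HeckeTranslates} {T : C.HeckeTranslates} {φ : Cₛ.G →* C.G} {hφ : Continuous φ}
    (h : Nonempty (Sec42Data.TowerHom Cₛ C Tₛ T φ hφ)) : Nonempty (Sec42Data.EtaleTowerHom Cₛ C Tₛ T φ hφ) :=
  h.map Sec42Data.TowerHom.toEtaleTowerHom

namespace Sec42Data.EtaleTowerHom

variable {Cₛ : Sec42Data P5ₛ isoₛ} {C : Sec42Data P5 iso} {Tₛ : Cₛ.HeckeTranslates} {T : C.HeckeTranslates}
  {φ : Cₛ.G →* C.G} {hφ : Continuous φ} (M' : Sec42Data.EtaleTowerHom Cₛ C Tₛ T φ hφ) (ℓ : ℕ) [Fact ℓ.Prime]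

/-- **Every étale receptacle's pull-back IS the constructed one** of its geometric part (★ `etPull_unique`: the defining square
pins `etPull`) — the étale structure carries no freedom beyond the morphism of towers. [cite: Liu2021, §4.3 l. 2158]
[cite: Milne2005ShimuraVarieties, Rem. 13.8 p. 119] -/
theorem etPull_eq_etPullLift : M'.etPull ℓ = M'.toTowerHom.etPullLift ℓ :=
  M'.toTowerHom.toEtaleTowerHom.etPull_unique ℓ M' rfl

end Sec42Data.EtaleTowerHom

end Sec42

end Literature.NumberTheory.Automorphic.Liu2021.AppendixC

end
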